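import Mathlib
import Literature.NumberTheory.Automorphic.ToricPseudoEisensteinUnfolding
import Literature.NumberTheory.Automorphic.QuotientRegularRepresentation
import HarnessLib

/-!
# Toric pseudo-Eisenstein series: the unwinding adjunction on the coset space `G ⧸ Γ`

Topic `NumberTheory/Automorphic`; namespace `Literature.NumberTheory.Automorphic.KernelModel`.

`ToricPseudoEisensteinUnfolding` proves the unwinding adjunction
`∫_{Γ\G} θ · E^χ_f = ∫_G f(h) (∫_{Γ_T\T} θ(t h) χ(t) dt) dh` [Garrett2018, §1.8] for the
pseudo-Eisenstein FUNCTION `E^χ_f` on `G` against a LEFT fundamental domain of `Γ`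
(`PseudoEisenstein.unfolding_theta`). The `L²`-model of `QuotientRegularRepresentation` lives on
Mathlib's coset space `G ⧸ Γ` with the quotient measure `μQ = map π (μ|𝓕)` of a RIGHT (`Γ.op`)
fundamental domain `𝓕`. This file transports the identity:

* `isInvInvariant_of_regular_of_isMulRightInvariant` : a regular left Haar measure that is also
  right invariant (unimodular group) is inversion invariant (the tree's
  `Literature.NumberTheory.Automorphic.isInvInvariant_of_isMulRightInvariant` assumes second
  countability instead of regularity; same proof);
* `isFundamentalDomain_inv` : for an inversion-invariant `μ`, `𝓕⁻¹` is a LEFT fundamental domain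
  when `𝓕` is a right one;
* `integral_quotient_eq_setIntegral_inv` : `∫_{G ⧸ Γ} F dμQ = ∫_{𝓕⁻¹} F(π(y⁻¹)) dμ(y)`;
* `unfolding_theta_quotient` : for a continuous kernel `θ_x : G ⧸ Γ → ℂ` with the equivariance
  `θ_{ω(h)x}(q) = θ_x(h⁻¹ • q)`,
  `∫_{G ⧸ Γ} θ_x · E^χ_f dμQ = ∫_G f(h) (∫_T β χ (t) θ_{ω(h)x}(π (jT t)⁻¹) dν(t)) dμ(h)`
  (with `RegularRep.EisQ` the descended pseudo-Eisenstein series).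

Provenance: HodgeCM PerL cell `pub-hodgecm`, package file `HodgeCM/Automorphic/KernelUnfolding.lean`
(seat pv15-g2, gate run 24) with the one lemma it uses from `HodgeCM/PerL34/QuotientSmoothingHaar.lean`
(`QuotientSmoothing.isInvInvariant_of_isMulRightInvariant`, seat pv, gate run 23) inlined; ported to
the tree under the LEAN-IN-TREE rule by seat pv15-g7 (names `HodgeCM.KernelModel.X` ↦
`Literature.NumberTheory.Automorphic.KernelModel.X`, statements verbatim).

## References

* P. Garrett, *Modern Analysis of Automorphic Forms by Example*, vol. 1 (2018), §1.8, §5.2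
  [Garrett2018].
* A. Deitmar, S. Echterhoff, *Principles of Harmonic Analysis*, 2nd ed. (2014), §1.4, Thm. 1.4.1 (d)
  (inversion invariance of Haar measure on a unimodular group) and §1.5 (quotient measures)
  [DeitmarEchterhoff2014].
-/

noncomputable section

open _root_.MeasureTheory MeasureTheory.Measure Set Filter Function
open scoped Pointwise ENNReal

namespace Literature.NumberTheory.Automorphic

namespace KernelModel

open Literature.NumberTheory.Automorphic.PseudoEisenstein Literature.NumberTheory.Automorphic.RegularRep

section Unimodular

variable {G : Type*} [Group G] [TopologicalSpace G] [IsTopologicalGroup G] [LocallyCompactSpace G]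
  [MeasurableSpace G] [BorelSpace G] (μ : Measure G) [IsHaarMeasure μ]

/-- A regular left Haar measure on a unimodular group (i.e. one which is also right invariant) is
invariant under `g ↦ g⁻¹`. (Proof as in Mathlib's abelian `IsHaarMeasure.isInvInvariant_of_regular`:
`μ.inv` is left invariant, hence `c • μ`; inverting twice gives `c² = 1`.)
[cite: DeitmarEchterhoff2014, Thm. 1.4.1 (d)] -/
theorem isInvInvariant_of_regular_of_isMulRightInvariant [μ.Regular] [μ.IsMulRightInvariant] :
    μ.IsInvInvariant := by
  constructor
  let c : ℝ≥0∞ := haarScalarFactor μ.inv μ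
  have hc : μ.inv = c • μ := isMulLeftInvariant_eq_smul_of_regular μ.inv μ
  have : map Inv.inv (map Inv.inv μ) = c ^ 2 • μ := by
    rw [← inv_def μ, hc, Measure.map_smul, ← inv_def μ, hc, smul_smul, pow_two]
  have μeq : μ = c ^ 2 • μ := by
    rw [map_map continuous_inv.measurable continuous_inv.measurable] at this
    simpa only [inv_involutive, Function.Involutive.comp_self, Measure.map_id]
  have K : TopologicalSpace.PositiveCompacts G := Classical.arbitrary _
  have : c ^ 2 * μ K = 1 ^ 2 * μ K := by
    conv_rhs => rw [μeq]
    simp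
  have : c ^ 2 = 1 ^ 2 :=
    (ENNReal.mul_left_inj (measure_pos_of_nonempty_interior _ K.interior_nonempty).ne'
          K.isCompact.measure_lt_top.ne).1 this
  have : c = 1 := (ENNReal.pow_right_strictMono two_ne_zero).injective this
  rw [hc, this, one_smul]

end Unimodular

section FD

variable {G : Type*} [Group G] [MeasurableSpace G] [MeasurableInv G] {Γ : Subgroup G}

/-- **Inversion turns a right fundamental domain into a left one** (for an inversion-invariant
measure). [folklore] -/
theorem isFundamentalDomain_inv (μ : Measure G) [μ.IsInvInvariant] {𝓕 : Set G}
    (h𝓕 : IsFundamentalDomain Γ.op 𝓕 μ) : IsFundamentalDomain Γ 𝓕⁻¹ μ := by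
  have h := h𝓕.preimage_of_equiv (ν := μ) (f := (Inv.inv : G → G))
    (Measure.measurePreserving_inv μ).quasiMeasurePreserving
    (e := fun g : Γ.op => (Γ.equivOp.symm g)⁻¹) ((Γ.equivOp.symm.trans (Equiv.inv Γ)).bijective)
    (fun g y => by
      change ((Γ.equivOp.symm g)⁻¹ • y)⁻¹ = g • y⁻¹
      rw [Subgroup.smul_def, Subgroup.smul_def, MulOpposite.smul_eq_mul_unop, smul_eq_mul, mul_inv_rev,
        Subgroup.coe_inv, inv_inv, Subgroup.equivOp_symm_apply_coe])
  simpa only [inv_preimage] using h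

end FD

section Quotient

variable {G : Type*} [Group G] [TopologicalSpace G] [IsTopologicalGroup G] [MeasurableSpace G]
  [BorelSpace G] {Γ : Subgroup G} [MeasurableSpace (G ⧸ Γ)] [BorelSpace (G ⧸ Γ)]

/-- `∫_{G ⧸ Γ} F dμQ = ∫_{𝓕⁻¹} F(π(y⁻¹)) dμ(y)` for `μQ = map π (μ|𝓕)`, `μ` inversion invariant,
`F` continuous. [folklore] -/
theorem integral_quotient_eq_setIntegral_inv (μ : Measure G) [μ.IsInvInvariant] (𝓕 : Set G)
    {μQ : Measure (G ⧸ Γ)} (hμQ : μQ = Measure.map (QuotientGroup.mk : G → G ⧸ Γ) (μ.restrict 𝓕))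
    (F : G ⧸ Γ → ℂ) (hF : Continuous F) :
    ∫ q, F q ∂μQ = ∫ y in 𝓕⁻¹, F (QuotientGroup.mk y⁻¹) ∂μ := by
  subst hμQ
  rw [integral_map (QuotientGroup.continuous_mk.measurable.aemeasurable) hF.aestronglyMeasurable]
  have h := (Measure.measurePreserving_inv μ).setIntegral_preimage_emb
    (MeasurableEquiv.inv G).measurableEmbedding (fun y => F (QuotientGroup.mk y)) 𝓕
  rw [inv_preimage] at h
  rw [← h]

end Quotient

section Unfolding

variable {G : Type*} [Group G] [TopologicalSpace G] [IsTopologicalGroup G] [T2Space G]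
  [LocallyCompactSpace G] [MeasurableSpace G] [BorelSpace G]
  {Γ : Subgroup G} [Countable Γ] [MeasurableSpace (G ⧸ Γ)] [BorelSpace (G ⧸ Γ)]
  {T : Type*} [Group T] [TopologicalSpace T] [T2Space T] [MeasurableSpace T] [OpensMeasurableSpace T]

/-- **Unfolding on the coset space**: for a right fundamental domain `𝓕` of `Γ` in `G` with
`μQ = map π (μ|𝓕)` (`μ` a left- and right-invariant regular Haar measure), a continuous kernel family
`θ : X → (G ⧸ Γ → ℂ)` with the equivariance `θ (ω h x) q = θ x (h⁻¹ • q)`, and `f ∈ C_c(G)`: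
`∫_{G ⧸ Γ} θ_x(q) E^χ_f(q) dμQ(q) = ∫_G f(h) (∫_T β(t)χ(t) θ_{ω(h)x}(π (jT t)⁻¹) dν(t)) dμ(h)`.
Proof: transport to the left fundamental domain `𝓕⁻¹` and apply `PseudoEisenstein.unfolding_theta`.
[cite: Garrett2018, §1.8] -/
theorem unfolding_theta_quotient
    (μ : Measure G) [μ.IsHaarMeasure] [μ.Regular] [μ.IsMulRightInvariant]
    (ν : Measure T) [IsFiniteMeasureOnCompacts ν]
    (jT : T →* G) (hjT : Continuous jT)
    (β : T → ℝ) (hβ : Continuous β) (hβs : HasCompactSupport β)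
    (χ : T → ℂ) (hχ : Continuous χ) (hΓ : DiscreteMeets Γ)
    (𝓕 : Set G) (h𝓕 : IsFundamentalDomain Γ.op 𝓕 μ)
    {μQ : Measure (G ⧸ Γ)} (hμQ : μQ = Measure.map (QuotientGroup.mk : G → G ⧸ Γ) (μ.restrict 𝓕))
    (f : G → ℂ) (hf : Continuous f) (hfs : HasCompactSupport f)
    {X : Type*} (θ : X → G ⧸ Γ → ℂ) (ω : G → X → X) (x : X)
    (hθ : Continuous (θ x)) (hθω : ∀ (h : G) (q : G ⧸ Γ), θ (ω h x) q = θ x (h⁻¹ • q)) :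
    ∫ q, θ x q * EisQ Γ ν jT β χ f q ∂μQ
      = ∫ h, f h * (∫ t, wt β χ t * θ (ω h x) (QuotientGroup.mk (jT t)⁻¹) ∂ν) ∂μ := by
  haveI : μ.IsInvInvariant := isInvInvariant_of_regular_of_isMulRightInvariant μ
  -- (1) to the left fundamental domain `𝓕⁻¹`
  have hE : Continuous (EisQ Γ ν jT β χ f) := continuous_EisQ ν jT hjT β hβ hβs χ hχ hΓ f hf hfs
  rw [integral_quotient_eq_setIntegral_inv μ 𝓕 hμQ (fun q => θ x q * EisQ Γ ν jT β χ f q) (hθ.mul hE)]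
  simp only [EisQ_mk, inv_inv]
  -- (2) the unfolding on `G` (`PseudoEisenstein.unfolding_theta`)
  have h𝓕' : IsFundamentalDomain Γ 𝓕⁻¹ μ := isFundamentalDomain_inv μ h𝓕
  have hθ' : Continuous fun y : G => θ x (QuotientGroup.mk y⁻¹) :=
    hθ.comp (QuotientGroup.continuous_mk.comp continuous_inv)
  have hθ'inv : ∀ (γ : Γ) (y : G), θ x (QuotientGroup.mk ((γ : G) * y)⁻¹) = θ x (QuotientGroup.mk y⁻¹) := by
    intro γ y
    rw [mul_inv_rev, QuotientGroup.mk_mul_of_mem _ (Γ.inv_mem γ.2)]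
  have hθ'ω : ∀ (h : G) (t : T),
      θ x (QuotientGroup.mk (jT t * h)⁻¹) = θ (ω h x) (QuotientGroup.mk (jT t)⁻¹) := by
    intro h t
    rw [hθω, mul_inv_rev, MulAction.Quotient.smul_mk, smul_eq_mul]
  exact unfolding_theta μ ν jT hjT β hβ hβs χ hχ Γ 𝓕⁻¹ h𝓕' f hf hfs
    (fun x' y => θ x' (QuotientGroup.mk y⁻¹)) ω x hθ' hθ'inv hθ'ω

end Unfolding

end KernelModel

end Literature.NumberTheory.Automorphic

end
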